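import Literature.AnabelianGeometry.AbsoluteAnabelian.AbsTopII.BelyiCuspidalizationContent
import Literature.AnabelianGeometry.AbsoluteAnabelian.AbsTopII.CuspidalizationComparisonSchemaScope
import HarnessLib

/-!
# [AbsTopII] Cor 3.7 with the content of (a) (`BelyiModel.Cor_3_7'`) SEPARATES from the frozen
# `BelyiModel.Cor_3_7`: the repaired chain clause consumes the cuspidal data of `X`
# (regression certificate for finding F-f064-1)

S. Mochizuki, *Topics in Absolute Anabelian Geometry II: Decomposition Groups and Endomorphisms*
[AbsTopII] (bib key `MochizukiAbsTopII2013`; manuscript pagination, lit key `paper:url-585b8d0ad0d9`):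
Example 3.6 pp. 71–72, Corollary 3.7 pp. 72–73; with [AbsTopI] (`MochizukiAbsTopI2012`) Def 4.2 (iii)
pp. 49–50: "(3_Π) … we shall refer to as a cuspidal decomposition group in `Δⱼ` any commensurator in
`Δⱼ` of a nontrivial image via `ρⱼ` of the inverse image in `Π̃` of the decomposition group in `Δ` of
a cusp of `X`"; "(c) Type •: … `Ker(φ)` is topologically normally generated by a cuspidal
decomposition group `C` in `Δⱼ`".

PROOF-ONLY scope / regression companion (no definition, no instance, no structure) of
abc-iut-L4-t6's `AbsTopII/BelyiCuspidalizationContent.lean` (p432148: `ChainGroup.IsDeCuspVia`,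
`BelyiCuspidalization.RealizesChain`, `BelyiModel.Cor_3_7'` — the repair of abc-iut-L4-lead RULING
#5w (1) for finding **F-f064-1**), cell abc-iut, seat abc-iut-f-064 (author of F-f064-1; certificates
p429324 / p429725 for FACT-LIST rows F-0267 / F-0268 / F-0232 / F-0271).  F-f064-1: the frozen
`BelyiModel.Cor_3_7` (p407799) follows from the slimness of the `Δ_{U_X}` of the model alone
(`cor_3_7_of_isSlimGroup_cuspOf_geom`), its chain clause `HasTerminalChainOfType …` being met by the
identity chain of type `⋏, ⋎, ⋏, ⋎`.  The repair `Cor_3_7'` asks the •-tail of a genuine `Π`-chain,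
read through terminal isomorphisms, to COMPOSE to the output's `Π_U ↠ Π_V` (`RealizesChain`).
abc-iut-L4-lead asked that a faithful restatement FAIL the witnesses of the finding; PROVED here:

* `ChainGroup.cuspidalDecompGroups_eq_empty_of_isEmpty`, `not_isDeCuspVia_of_isEmpty`,
  `not_isElemOp_deCusp_of_isEmpty`, `PiChain.types_ne_deCusp_of_isEmpty` — by (3_Π) the • steps kill
  cuspidal decomposition groups coming from cusps OF `X`: with no cusp recorded on `X` (empty
  cuspidal data on `Π`) no elementary operation of type • exists in any term;
* `BelyiCuspidalization.RealizesChain.projU_injective_of_isEmpty` (`.nonempty_cusp_of_not_injective`)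
  — so a chain realized relative to empty cuspidal data has an EMPTY •-tail and the output's
  `Π_U ↠ Π_V` is a composite of isomorphisms, injective; `cusp_arith_injective_of_projU_injective` — then the OUTPUT `Π_{U_X} ↠ Π`
  is injective (`Π_U = Π_V ×_Π Π_{U_X}` via `glue`, `Ker ⊆ Π_U`); `Cuspidalization.IsoOver.injective_right`;
* `BelyiModel.not_cor_3_7'_of_isEmpty_cusp` — KERNEL FORM of "the repair consumes `M.cusps b X`": a
  member meeting the standing hypotheses with NO recorded cusp and an NF-open whose `Π_{U_X} ↠ Π` is
  not injective violates `Cor_3_7'`, whatever the slimness of `Π_{U_X}`;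
  `Cor_3_7'.cuspOf_injective_of_isEmpty_cusp`; `cor_3_7'_of_isEmpty_nfOpen` (vacuous instance form;
  the non-vacuous one — point-preserving NF-opens — is the sibling
  `BelyiCuspidalizationContentPointPreserving.lean`);
* `BelyiModel.exists_cor_3_7_and_not_cor_3_7'` — **THE REGRESSION CERTIFICATE** (universe `0`): the
  junk class over the REAL field `ℚ_2` of p429725 (rel-isom-DGC by construction, chain-full, every
  member `Π := G × G ↠ G`, `G := Gal(ℚ̄_2/ℚ_2)`, satisfying `IsCor37Member` UNCONDITIONALLY by
  [Tpcs] Lem 4.14 / [AbsTopI] Ex 4.8 (i) kernel theorems) with NO cusps recorded and on every member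
  ONE NF-open with cuspidalization the first projection `(G × G) × G ↠ G × G` — `Δ_{U_X} ≅ G × G`
  SLIM — satisfies the frozen `Cor_3_7` (by exactly the witness of F-f064-1) and VIOLATES `Cor_3_7'`;
* `BelyiModel.not_forall_cor_3_7'_of_isSlimGroup_cuspOf_geom` — `Cor_3_7'` is NOT implied by the
  classical input (slim `Δ_{U_X}`) that implies `Cor_3_7`: the repair bites;
  `not_forall_cor_3_7'_of_cor_3_7`; `not_forall_cor_3_7'` — the universal closure of the repaired
  predicate is refuted (a HYPOTHESIS ON `(𝒟, M)`, bindable per instance, like `Cor_3_7`).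

READING (honest framing): statements about OUR typed interface.  The junk model records no cusp on
a member "of strictly Belyi type" and lets an NF-open identify points — free model data no étale
`π₁` would supply (a hyperbolic orbicurve of strictly Belyi type, Def 3.5, has cusps; the tree does
not construct `π₁`, FOUNDATIONS row 12).  NOTHING in print is contradicted; refuted-as-schema ≠
refuted-in-print; content-light / content-bearing are statements about OUR typing; no side taken on
[IUTchIII] Cor 3.12; typed ≠ proved.
-/

open CategoryTheory Topology
open scoped Pointwise

universe u

namespace Literature.AnabelianGeometry.AbsoluteAnabelian

open Literature.AlgebraicGeometry.Frobenioids (IsSlimGroup)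

/-! ## (3_Π) with no cusp recorded on `X`: no elementary operation of type • -/

namespace FundamentalExtension.ChainGroup

variable {E : FundamentalExtension.{u}}

/-- With NO cusp recorded on `X` (empty cuspidal data `C` on `Π`), no term `Πⱼ` of a `Π`-chain has a
cuspidal decomposition group in the sense of [AbsTopI] Def 4.2 (iii) (3_Π) ("any commensurator in
`Δⱼ` of a nontrivial image via `ρⱼ` of the inverse image in `Π̃` of the decomposition group in `Δ` of
a cusp of `X`"). [cite: MochizukiAbsTopI2012, Def 4.2 (iii) p.49] -/
theorem cuspidalDecompGroups_eq_empty_of_isEmpty (L : E.ChainGroup) (C : CuspidalData E)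
    (hC : IsEmpty C.Cusp) : L.cuspidalDecompGroups C = ∅ := by
  ext D
  simp only [Set.mem_empty_iff_false, iff_false]
  rintro ⟨x, -⟩
  exact hC.elim x

/-- Hence, with no cusp recorded on `X`, NO homomorphism `φ : Πⱼ → Πⱼ₊₁` is an elementary operation
of type • ([AbsTopI] Def 4.2 (iii)(c): "`Ker(φ)` is topologically normally generated by a cuspidal
decomposition group `C` in `Δⱼ`"; abc-iut-L4-t6's `IsDeCuspVia`).
[cite: MochizukiAbsTopI2012, Def 4.2 (iii) p.50] -/
theorem not_isDeCuspVia_of_isEmpty (C : CuspidalData E) (hC : IsEmpty C.Cusp) (L L' : E.ChainGroup)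
    (φ : L.grp →ₜ* L'.grp) : ¬ IsDeCuspVia C L L' φ := by
  rintro ⟨-, -, D, hD, -⟩
  rw [L.cuspidalDecompGroups_eq_empty_of_isEmpty C hC] at hD
  exact hD

/-- The same for abc-iut-L4-t4's existential form `IsElemOp C .deCusp` ([AbsTopI] Def 4.2 (iii)(c)):
with no cusp recorded on `X`, no step `Πⱼ ⇝ Πⱼ₊₁` of type • exists.
[cite: MochizukiAbsTopI2012, Def 4.2 (iii) p.50] -/
theorem not_isElemOp_deCusp_of_isEmpty (C : CuspidalData E) (hC : IsEmpty C.Cusp)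
    (L L' : E.ChainGroup) : ¬ IsElemOp C .deCusp L L' := by
  rintro ⟨φ, -, -, D, hD, -⟩
  rw [L.cuspidalDecompGroups_eq_empty_of_isEmpty C hC] at hD
  exact hD

/-- Consequently a `Π`-chain relative to empty cuspidal data has no symbol • in its type-chain: it is
a chain of `⋏`'s, `⋎`'s (and `⊚`'s) only. [cite: MochizukiAbsTopI2012, Def 4.2 (iii) p.50] -/
theorem _root_.Literature.AnabelianGeometry.AbsoluteAnabelian.FundamentalExtension.PiChain.types_ne_deCusp_of_isEmpty
    {C : CuspidalData E} {hP : IsSlimGroup E.arith} {hΔ : IsSlimGroup E.geom} {hne : E.geom ≠ ⊥}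
    (c : E.PiChain C hP hΔ hne) (hC : IsEmpty C.Cusp) (j : Fin c.len) :
    c.types j ≠ .deCusp := by
  intro hj
  have h := c.isElemOp j
  rw [hj] at h
  exact not_isElemOp_deCusp_of_isEmpty C hC _ _ h

end FundamentalExtension.ChainGroup

namespace AbsTopII

open FundamentalExtension
open AbsTopI (ConstructionDataClass)
open AbsTopIII (IsGeneralizedSubpadicFor IsSubpadicFor cyclotomicChar)

/-! ## What `RealizesChain` forces when no cusp of `X` is recorded -/

namespace BelyiCuspidalization

variable {E : FundamentalExtension.{u}} {C : CuspidalData E} {hP : IsSlimGroup E.arith}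
  {hΔ : IsSlimGroup E.geom} {hne : E.geom ≠ ⊥}

/-- **An output realizing a chain relative to EMPTY cuspidal data has `Π_U ↠ Π_V` injective.**  In
`RealizesChain` (Cor 3.7 (a): "the natural surjection `Π_U ↠ Π_V` may be recovered from the chain of
•’s terminating at the second to last group") every step `Πⱼ ⇝ Πⱼ₊₁` with `s ≤ j < t` is of type •;
with no cusp recorded no such step exists (`not_isDeCuspVia_of_isEmpty`), so `s = t`, the tracked
composite `ψ_t` is the isomorphism `Π_U ⥲ Π_s`, and `Π_U ↠ Π_V`, read through `Π_t ⥲ Π_V ⊆ Π`, is a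
composite of isomorphisms. [cite: MochizukiAbsTopII2013, Cor 3.7 (a) p.73] -/
theorem RealizesChain.projU_injective_of_isEmpty {B : BelyiCuspidalization E}
    (h : B.RealizesChain C hP hΔ hne) (hC : IsEmpty C.Cusp) : Function.Injective B.projU.arith := by
  obtain ⟨c, -, -, s, t, hst, ht, eU, eV, -, -, ψ, -, -, hψs, htail, hlast⟩ := h
  -- the •-tail is empty: a step of type • would need a cusp of `X`
  have hts : t.val = s.val := by
    by_contra hts
    have hlt : s.val < t.val := by omega
    have hsl : s.val < c.len := by omega
    obtain ⟨φ, hφ, -⟩ := htail ⟨s.val, hsl⟩ le_rfl hlt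
    exact ChainGroup.not_isDeCuspVia_of_isEmpty C hC _ _ φ hφ
  obtain rfl : t = s := Fin.ext hts
  intro x y hxy
  have hx := hlast x
  have hy := hlast y
  rw [hψs] at hx hy
  rw [← hx, ← hy] at hxy
  exact eU.injective (eV.symm.injective (Subtype.val_injective hxy))

/-- Contrapositive: an output whose `Π_U ↠ Π_V` identifies two elements realizes a `Π`-chain only
if some cusp of `X` is recorded. [cite: MochizukiAbsTopII2013, Cor 3.7 (a) p.73] -/
theorem RealizesChain.nonempty_cusp_of_not_injective {B : BelyiCuspidalization E}
    (h : B.RealizesChain C hP hΔ hne) (hU : ¬ Function.Injective B.projU.arith) :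
    Nonempty C.Cusp := by
  rw [← not_isEmpty_iff]
  exact fun hC => hU (h.projU_injective_of_isEmpty hC)

/-- **`Π_U ↠ Π_V` injective forces the OUTPUT `Π_{U_X} ↠ Π` injective** (Cor 3.7 (a)/(b):
"`Π_U := Π_V ×_Π Π_{U_X}`", "`Π_{U_X} ↠ Π` may be recovered from `Π_U ↠ Π_V`"): the kernel of
`Π_{U_X} ↠ Π` lies in `Π_U` (`ker_le_PiU`), on which `Π_{U_X} ↠ Π` is `Π_U ↠ Π_V` through `glue`.
[cite: MochizukiAbsTopII2013, Cor 3.7 (b) p.73] -/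
theorem cusp_arith_injective_of_projU_injective (B : BelyiCuspidalization E)
    (h : Function.Injective B.projU.arith) : Function.Injective B.cusp.hom.arith := by
  refine (injective_iff_map_eq_one B.cusp.hom.arith).2 fun y hy => ?_
  have hyU : y ∈ B.PiV.comap B.cusp.hom.arith.toMonoidHom :=
    B.ker_le_PiU (show B.cusp.hom.arith.toMonoidHom y = 1 from hy)
  have h1 : B.projU.arith (B.glue ⟨y, hyU⟩) = B.projU.arith 1 := by
    rw [← B.glue_comm ⟨y, hyU⟩, map_one]
    exact hy
  have h2 : (⟨y, hyU⟩ : ↥(B.PiV.comap B.cusp.hom.arith.toMonoidHom)) = 1 :=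
    B.glue.injective (by rw [h h1, map_one])
  exact congrArg Subtype.val h2

end BelyiCuspidalization

/-- Injectivity of `Π_{U_X} ↠ Π` is transported along "isomorphic over `Π`" (Cor 3.8: "compatible
with `φ`, relative to the natural surjections"). [cite: MochizukiAbsTopII2013, Cor 3.8 p.74] -/
theorem Cuspidalization.IsoOver.injective_right {E : FundamentalExtension.{u}}
    {c c' : Cuspidalization E} (h : c.IsoOver c') (hc : Function.Injective c.hom.arith) :
    Function.Injective c'.hom.arith := by
  obtain ⟨β, hβ⟩ := h
  intro x y hxy
  obtain ⟨x, rfl⟩ := β.surjective x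
  obtain ⟨y, rfl⟩ := β.surjective y
  rw [hβ, hβ] at hxy
  rw [hc hxy]

/-! ## `Cor_3_7'` consumes the cuspidal data of `X` -/

variable {𝒟 : ConstructionDataClass.{u}}

namespace BelyiModel

variable (M : BelyiModel 𝒟)

/-- **KERNEL FORM of "the repaired Cor 3.7 consumes `M.cusps b X`"**: over a chain-full class with
rel-isom-DGC, a member `X` satisfying the standing hypotheses of Cor 3.7 with NO recorded cusp and an
NF-open `U_X` whose `Π_{U_X} ↠ Π` is not injective violates `Cor_3_7'` — whatever the slimness of
`Π_{U_X}` (contrast `cor_3_7_of_isSlimGroup_cuspOf_arith` for the frozen `Cor_3_7`).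
[cite: MochizukiAbsTopII2013, Cor 3.7 pp.72-73] -/
theorem not_cor_3_7'_of_isEmpty_cusp (hfull : 𝒟.IsChainFull) (hGC : 𝒟.RelIsomDGC)
    {b : 𝒟.Base} {X : (𝒟.datum b).Obj} (h : M.IsCor37Member b X)
    (hC : IsEmpty (M.cusps b X).Cusp) (U : M.NFOpen b X)
    (hU : ¬ Function.Injective (M.cuspOf U).hom.arith) : ¬ M.Cor_3_7' := by
  intro h37
  obtain ⟨B, hiso, -, hreal⟩ := h37 hfull hGC b X h U
  exact hU (hiso.injective_right
    (B.cusp_arith_injective_of_projU_injective (hreal.projU_injective_of_isEmpty hC)))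

/-- Under `Cor_3_7'` an NF-open of a member with no recorded cusp removes no point.
[cite: MochizukiAbsTopII2013, Cor 3.7 pp.72-73] -/
theorem Cor_3_7'.cuspOf_injective_of_isEmpty_cusp {M : BelyiModel 𝒟} (h37 : M.Cor_3_7')
    (hfull : 𝒟.IsChainFull) (hGC : 𝒟.RelIsomDGC) {b : 𝒟.Base} {X : (𝒟.datum b).Obj}
    (h : M.IsCor37Member b X) (hC : IsEmpty (M.cusps b X).Cusp) (U : M.NFOpen b X) :
    Function.Injective (M.cuspOf U).hom.arith := by
  by_contra hU
  exact M.not_cor_3_7'_of_isEmpty_cusp hfull hGC h hC U hU h37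

/-- Instance form that holds VACUOUSLY: a model none of whose members has an NF-rational open
satisfies `Cor_3_7'`. [cite: MochizukiAbsTopII2013, Cor 3.7 pp.72-73] -/
theorem cor_3_7'_of_isEmpty_nfOpen
    (h : ∀ (b : 𝒟.Base) (X : (𝒟.datum b).Obj), IsEmpty (M.NFOpen b X)) : M.Cor_3_7' :=
  fun _ _ b X _ U => (h b X).elim U

end BelyiModel

/-! ## The regression certificate: a model of `Cor_3_7` (via slim `Δ_{U_X}`) violating `Cor_3_7'` -/

/-- **REGRESSION CERTIFICATE for F-f064-1** (universe `0`).  The junk class over `ℚ_2` of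
`CuspidalizationComparisonSchemaScope.lean` (one construction-data field `ℚ_2`; ONE relative
anabelian datum over `G := Gal(ℚ̄_2/ℚ_2)` with objects `tt`, `ff`, group `Π := G × G ↠ G` (second
projection, `Δ = G × 1`), `Hom :=` the outer ISOMORPHISMS over `G` — rel-isom-DGC by construction —,
no chain terms — chain-full —, all objects members with `Σ := Primes`) with the model: NO cusps
recorded, every member of strictly Belyi type by fiat, and on every member ONE NF-open whose
cuspidalization is the first projection `(G × G) × G ↠ G × G` (no cusps recorded on `U_X` either).
Every member satisfies `IsCor37Member` UNCONDITIONALLY; every `Δ_{U_X} ≅ G × G` is SLIM (hence every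
`Π_{U_X}`, [AbsAnab] Lem 1.3.1), so the frozen `Cor_3_7` HOLDS by `cor_3_7_of_isSlimGroup_cuspOf_geom`
— the witness of finding F-f064-1 —; but `Π_{U_X} ↠ Π` kills `1 × 1 × G ≠ 1`, so `Cor_3_7'` FAILS
by `not_cor_3_7'_of_isEmpty_cusp`. [cite: MochizukiAbsTopII2013, Cor 3.7 pp.72-73] -/
theorem BelyiModel.exists_cor_3_7_and_not_cor_3_7' :
    ∃ (𝒟 : ConstructionDataClass.{0}) (M : BelyiModel 𝒟),
      𝒟.IsChainFull ∧ 𝒟.RelIsomDGC ∧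
      (∀ (b : 𝒟.Base) (X : (𝒟.datum b).Obj), M.IsCor37Member b X) ∧
      (∀ (b : 𝒟.Base) (X : (𝒟.datum b).Obj), Nonempty (M.NFOpen b X)) ∧
      (∀ (b : 𝒟.Base) (X : (𝒟.datum b).Obj) (U : M.NFOpen b X),
        IsSlimGroup (M.cuspOf U).ext.geom ∧ IsSlimGroup (M.cuspOf U).ext.arith) ∧
      M.Cor_3_7 ∧ ¬ M.Cor_3_7' := by
  let Γ : ProfiniteGrp.{0} := absoluteGaloisGrp ℚ_[2]
  -- the member: `Π := G × G ↠ G` (second projection)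
  let P : AugmentedProfiniteGrp Γ :=
    { arith := ProfiniteGrp.of (Γ × Γ), aug := ContinuousMonoidHom.snd Γ Γ
      aug_surjective := fun g => ⟨(1, g), rfl⟩ }
  let D : RelativeAnabelianDatum Γ :=
    { Obj := Bool
      Hom := fun _ _ => {q : AugmentedProfiniteGrp.OuterHom P P // q.IsIso}
      IsIso := fun _ => True
      IsHyperbolicCurve := fun _ => True
      primes := Set.univ
      grp := fun _ => P
      outerHom := fun q => q.1 }
  let 𝒟 : ConstructionDataClass.{0} :=
    { Base := PUnit.{1}
      fld := fun _ => ℚ_[2]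
      instField := fun _ => inferInstance
      instCharZero := fun _ => inferInstance
      datum := fun _ => D
      Mem := fun _ _ => True
      IsHyperbolicOrbicurve := fun _ _ => True
      isHyperbolicOrbicurve_of_isHyperbolicCurve := fun _ _ _ => trivial
      chainTerms := fun _ _ => ∅ }
  let E₀ : FundamentalExtension.{0} := P.toExtension
  let C₀ : CuspidalData E₀ :=
    { Cusp := PEmpty.{1}
      Dcusp := fun x => x.elim
      Icusp := fun x => x.elim
      Icusp_eq := fun x => x.elim
      isClosed_Dcusp := fun x => x.elim
      eq_of_conj := fun x => x.elim }
  -- the junk cuspidalization `Π_{U_X} := (G × G) × G ↠ G × G` (first projection), SLIM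
  let E₁ : FundamentalExtension.{0} :=
    { arith := ProfiniteGrp.of ((Γ × Γ) × Γ), gal := Γ
      aug := (ContinuousMonoidHom.snd Γ Γ).comp (ContinuousMonoidHom.fst (Γ × Γ) Γ)
      aug_surjective := fun g => ⟨((1, g), 1), rfl⟩ }
  let f : E₁ ⟶ E₀ := ⟨ContinuousMonoidHom.fst (Γ × Γ) Γ, ContinuousMonoidHom.id Γ, fun _ => rfl⟩
  let c : Cuspidalization E₀ := ⟨E₁, f, fun g => ⟨(g, 1), rfl⟩, Function.bijective_id⟩
  let C₁ : CuspidalData E₁ :=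
    { Cusp := PEmpty.{1}
      Dcusp := fun x => x.elim
      Icusp := fun x => x.elim
      Icusp_eq := fun x => x.elim
      isClosed_Dcusp := fun x => x.elim
      eq_of_conj := fun x => x.elim }
  let M : BelyiModel 𝒟 :=
    { cusps := fun _ _ => C₀
      IsStrictlyBelyiType := fun _ _ => True
      NFOpen := fun _ _ => PUnit.{1}
      cuspOf := fun _ => c
      cuspsOf := fun _ => C₁ }
  have hfull : 𝒟.IsChainFull := fun _ _ _ _ ht => ((Set.mem_empty_iff_false _).mp ht).elim
  have hGC : 𝒟.RelIsomDGC := fun _ _ _ _ _ =>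
    ⟨fun q _ => q.2, fun q _ q' _ h => Subtype.ext h, fun q hq => ⟨⟨q, hq⟩, trivial, rfl⟩⟩
  have hk : IsGeneralizedSubpadicFor ℚ_[2] 2 := (IsSubpadicFor.padic 2).isGeneralizedSubpadicFor
  have hΓ : IsSlimGroup Γ :=
    isSlimGroup_of_iso_absoluteGaloisGrp_of_isGeneralizedSubpadicFor_holds hk (Iso.refl _)
  -- `Δ = G × 1 ≅ G` is slim …
  let e : Γ ≃ₜ* ↥E₀.geom :=
    { toFun := fun g => ⟨(g, 1), rfl⟩
      invFun := fun x => x.1.1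
      left_inv := fun _ => rfl
      right_inv := fun x => by
        obtain ⟨⟨g, h⟩, hx⟩ := x
        have hh : h = 1 := hx
        subst hh
        rfl
      map_mul' := fun g h => Subtype.ext (Prod.ext rfl (one_mul (1 : Γ)).symm)
      continuous_toFun := Continuous.subtype_mk (continuous_id.prodMk continuous_const) _
      continuous_invFun := continuous_fst.comp continuous_subtype_val }
  have hΔ : IsSlimGroup ↥E₀.geom := isSlimGroup_of_continuousMulEquiv e hΓ
  -- … and nontrivial
  haveI : Infinite (Field.absoluteGaloisGroup ℚ_[2]) := Padic.infinite_absoluteGaloisGroup 2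
  obtain ⟨σ, hσ⟩ := exists_ne (1 : Field.absoluteGaloisGroup ℚ_[2])
  have hne : E₀.geom ≠ ⊥ := by
    intro h
    have hmem : ((σ, 1) : Γ × Γ) ∈ E₀.geom := rfl
    rw [h] at hmem
    exact hσ (Prod.mk_eq_one.mp (Subgroup.mem_bot.mp hmem)).1
  have hX : ∀ X : Bool, M.IsCor37Member PUnit.unit X := fun X =>
    M.isCor37Member_of_isGeneralizedSubpadicFor trivial rfl trivial hk hΔ hne
  -- `Π = G × G` is slim ([AbsAnab] Lem 1.3.1), hence so is `Δ_{U_X} = G × 1 × G ≅ G × G` …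
  have hPi : IsSlimGroup (Γ × Γ) := (hX true).arith_slim
  let e₁ : (Γ × Γ) ≃ₜ* ↥E₁.geom :=
    { toFun := fun g => ⟨((g.1, 1), g.2), rfl⟩
      invFun := fun x => (x.1.1.1, x.1.2)
      left_inv := fun _ => rfl
      right_inv := fun x => by
        obtain ⟨⟨⟨g, h⟩, k⟩, hx⟩ := x
        have hh : h = 1 := hx
        subst hh
        rfl
      map_mul' := fun g h => Subtype.ext (Prod.ext (Prod.ext rfl (one_mul (1 : Γ)).symm) rfl)
      continuous_toFun := Continuous.subtype_mk
        ((continuous_fst.prodMk continuous_const).prodMk continuous_snd) _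
      continuous_invFun := (continuous_fst.comp (continuous_fst.comp continuous_subtype_val)).prodMk
        (continuous_snd.comp continuous_subtype_val) }
  have hΔ₁ : IsSlimGroup ↥E₁.geom := isSlimGroup_of_continuousMulEquiv e₁ hPi
  -- … and `Π_{U_X}` is slim ([AbsAnab] Lem 1.3.1 again)
  have hPi₁ : IsSlimGroup E₁.arith := E₁.arith_slim_of_geom_slim_of_gal_slim hΔ₁ hΓ
  -- `Π_{U_X} ↠ Π` kills the nontrivial element `((1, 1), σ)`
  have hninj : ¬ Function.Injective c.hom.arith := by
    intro hinj
    have h1 : c.hom.arith (((1, 1), σ) : (Γ × Γ) × Γ) = c.hom.arith 1 := rfl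
    exact hσ (Prod.mk_eq_one.mp (hinj h1)).2
  have hC : IsEmpty (M.cusps PUnit.unit true).Cusp := inferInstanceAs (IsEmpty PEmpty.{1})
  refine ⟨𝒟, M, hfull, hGC, fun _ X => hX X, fun _ _ => ⟨PUnit.unit⟩,
    fun _ _ _ => ⟨hΔ₁, hPi₁⟩, ?_, ?_⟩
  · exact M.cor_3_7_of_isSlimGroup_cuspOf_geom fun _ _ _ _ => hΔ₁
  · exact M.not_cor_3_7'_of_isEmpty_cusp hfull hGC (hX true) hC PUnit.unit hninj

/-- **The repair bites: `Cor_3_7'` is NOT implied by the classical input that implies the frozen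
`Cor_3_7`** (slim `Δ_{U_X}`; compare `BelyiModel.cor_3_7_of_isSlimGroup_cuspOf_geom`, p429725) — the
regression abc-iut-L4-lead RULING #5w (1) asked a faithful restatement of Cor 3.7 (a) to fail.
[cite: MochizukiAbsTopII2013, Cor 3.7 pp.72-73] -/
theorem BelyiModel.not_forall_cor_3_7'_of_isSlimGroup_cuspOf_geom :
    ¬ ∀ (𝒟 : ConstructionDataClass.{0}) (M : BelyiModel 𝒟),
      (∀ (b : 𝒟.Base) (X : (𝒟.datum b).Obj), M.IsCor37Member b X → ∀ U : M.NFOpen b X,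
        IsSlimGroup (M.cuspOf U).ext.geom) → M.Cor_3_7' := by
  intro H
  obtain ⟨𝒟, M, -, -, -, -, hslim, -, h37⟩ := BelyiModel.exists_cor_3_7_and_not_cor_3_7'
  exact h37 (H 𝒟 M fun b X _ U => (hslim b X U).1)

/-- In particular the frozen `Cor_3_7` does NOT imply `Cor_3_7'` schematically (the converse,
`Cor_3_7' → Cor_3_7`, is abc-iut-L4-t6's `cor_3_7_of_cor_3_7'`): the two predicates SEPARATE on a
model meeting every hypothesis of Cor 3.7. [cite: MochizukiAbsTopII2013, Cor 3.7 pp.72-73] -/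
theorem BelyiModel.not_forall_cor_3_7'_of_cor_3_7 :
    ¬ ∀ (𝒟 : ConstructionDataClass.{0}) (M : BelyiModel 𝒟), M.Cor_3_7 → M.Cor_3_7' := by
  intro H
  obtain ⟨𝒟, M, -, -, -, -, -, h37, h37'⟩ := BelyiModel.exists_cor_3_7_and_not_cor_3_7'
  exact h37' (H 𝒟 M h37)

/-- **Universal closure of the repaired predicate REFUTED** (universe `0`): `BelyiModel.Cor_3_7'` is —
like `Cor_3_7` (F-0232, `BelyiModel.not_forall_cor_3_7`) — a HYPOTHESIS ON `(𝒟, M)`, bindable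
per instance (the étale-`π₁` class of [AbsTopI] Ex 4.8 (i)), not a closed fact.  Cor 3.7 itself is
not touched. [cite: MochizukiAbsTopII2013, Cor 3.7 pp.72-73] -/
theorem BelyiModel.not_forall_cor_3_7' :
    ¬ ∀ (𝒟 : ConstructionDataClass.{0}) (M : BelyiModel 𝒟), M.Cor_3_7' := by
  intro H
  obtain ⟨𝒟, M, -, -, -, -, -, -, h37'⟩ := BelyiModel.exists_cor_3_7_and_not_cor_3_7'
  exact h37' (H 𝒟 M)

end AbsTopII

end Literature.AnabelianGeometry.AbsoluteAnabelian
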